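import Summits.QuantumFields.YangMills.Theorems.UnitScaleTiltProp7V0CurrentRealityT3
import Summits.QuantumFields.YangMills.Theorems.UnitScaleTiltProp7RCOfRowsFamily
import HarnessLib

/-!
# (R-V₀) E2E — THE EX DISPLAY'S ROW `hV0` FROM THE N06 ROW `norm_Hπ` AND THE SECT. C NUMERICS ALONE (the exact term the S16 namer feeds)

Route `UnitScaleTilt`, crux EX `MinimiserStabilityRegPr` (stmt-QuantumFields-19200), display of record S15ᴰ ✓p684527.  Composition BY NAME, kernel-certified here so the namer's
sed is a one-liner: ★★★`hV0_of_normHπ_family := Prop7V0CurrentReality.hV0_of_RC_family … (Prop7RCOfRowsFamily.hRC_of_rows_family_B₀ …)` — the family row `hV0`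
((R-V₀): the composed V₀-group current (90)–(96) is Hermitian-traceless-valued) VERBATIM, from `norm_Hπ` (S15ᴰ's displayed N06 letter, VERBATIM), `hB₀ hα hef hWe hWε ha`,
and px14's four Sect. C numerics `hεC hdomC hselfC hcontrC` (S15ᴰ binders, VERBATIM) — i.e. ONLY hypotheses S15ᴰ already displays; so `hV0` leaves the display with
nothing entering.  [Balaban1985Variational] (51) p.286, (90)–(96) pp.291–292, (117)–(121) p.295; [Balaban1985BackgroundPropagators] p.393.
HONEST SCOPE: bookkeeping over ✓p684789 and ✓p682625; no estimate; the EX stub is not touched; rung R3, not Clay.  Helper (`--supports`), def-free, sorry-free.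
-/

set_option autoImplicit false

noncomputable section

open scoped InnerProductSpace ComplexConjugate Matrix.Norms.L2Operator BigOperators

namespace Summit.QuantumFields.YangMills.Theorems.Prop7V0CurrentRealityE2E

open Literature.MathematicalPhysics.QuantumFieldTheory.Balaban1983to89
open Literature.MathematicalPhysics.QuantumFieldTheory.Balaban1983to89.T3ContinuumYM3Torus
open Literature.MathematicalPhysics.QuantumFieldTheory.Balaban1983to89.T3Thm1Carrier
open T3SectALandauChart (eta eta_pos)
open T3PrintedRegularMinimiser (RegPr)
open B9SectCLatticeCarrier (Bond)
open B11Eq115Space (NegSup NegSize Space115 JetSup levWeight)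
open B11Eq111FrakG (nabla115)
open B11Eq174Chart (Regime)
open B11Eq90V0GroupComposed (curV0full)
open B11Eq98V0primeCurrentSlots (rieszτ)
open Summit.QuantumFields.YangMills.Theorems.Prop7SectET3Transport (periodsT3 siteEquiv bondEquiv bgOfCfg)
open Summit.QuantumFields.YangMills.Theorems.Prop7SectET3HilbertLetters (W₂ frobEquiv toL2)
open Summit.QuantumFields.YangMills.Theorems.Prop7SectET3CurvedPropagators (H1f)
open Summit.QuantumFields.YangMills.Theorems.Prop7SectET3DeltaPiPInv (DeltaPiSlotP)
open Summit.QuantumFields.YangMills.Theorems.Prop7SymAvgTwSym (CmapTwS)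
open Summit.QuantumFields.YangMills.Theorems.Prop7RCOfRowsFamily (hRC_of_rows_family_B₀)
open Summit.QuantumFields.YangMills.Theorems.Prop7V0CurrentReality (hV0_of_RC_family)

/-- ★★★ **THE ROW `hV0` OF THE EX DISPLAY (S15ᴰ ✓p684527 :183, VERBATIM) FROM `norm_Hπ` + THE SECT. C NUMERICS** — `hV0_of_RC_family ∘ hRC_of_rows_family_B₀`, by name.
[cite: Balaban1985Variational, (51) p.286, (90)–(96) pp.291–292, (117)–(121) p.295; Balaban1985BackgroundPropagators, p.393] -/
theorem hV0_of_normHπ_family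
    [hFL : ∀ F : T3Family, Fact (0 < (F.L : ℝ))] [hFη : ∀ (F : T3Family) (k : ℕ), Fact (0 < ((F.L : ℝ)⁻¹) ^ k)]
    (B₀ α a₃ ef εC : ℕ → ℝ) (hB₀ : ∀ L, 1 < L → 0 < B₀ L) (hα : ∀ L, 1 < L → 0 < α L) (hef : ∀ L, 1 < L → 0 < ef L)
    (hWe : ∀ L : ℕ, 1 < L → 10 ^ 9 * (L : ℝ) ^ 2 * ef L ≤ 1) (hWε : ∀ L : ℕ, 1 < L → 10 ^ 12 * (L : ℝ) ^ 3 * α L ≤ 1)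
    (c₀ cB : ℕ → ℝ) [hc₀ : ∀ L : ℕ, Fact (0 < c₀ L)] [hcB : ∀ L : ℕ, Fact (0 < cB L)]
    (a : ∀ L : ℕ, Idx L → ℝ) (ha : ∀ (L : ℕ) (i : Idx L), 0 < a L i)
    (norm_Hπ : ∀ (L : ℕ), 1 < L → ∀ (i : Idx L) (ρ : ℝ) (U₀ : GaugeField (i.1.1.P i.1.2.2) 0 (Matrix.specialUnitaryGroup (Fin 2) ℂ)),
      RegPr i.1.1 i.1.2.1 i.1.2.2 ρ U₀ → ρ ≤ α L → ∀ b, ‖H1f i.1.1 i.1.2.1 i.1.2.2 i.2.2.le (c₀ L) (cB L) (a L i) (DeltaPiSlotP i.1.1 i.1.2.1 i.1.2.2 i.2.2.le (c₀ L) (cB L) (a L i)) U₀ b‖ ≤ B₀ L * ‖b‖)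
    (hεC : ∀ L : ℕ, 1 < L → 0 ≤ εC L)
    (hdomC : ∀ L : ℕ, 1 < L → 2 * (εC L + a₃ L) ≤ ef L / 2)
    (hselfC : ∀ L : ℕ, 1 < L → B₀ L * (40 * (2 * (3 * (2 * ef L + 2700 * (L : ℝ) * α L))) / ef L ^ 2) * (εC L + a₃ L) ^ 2 ≤ εC L)
    (hcontrC : ∀ L : ℕ, 1 < L → 4 * B₀ L * (40 * (2 * (3 * (2 * ef L + 2700 * (L : ℝ) * α L))) / ef L ^ 2) * (εC L + a₃ L) < 1) :
    ∀ (L : ℕ), 1 < L → ∀ (i : Idx L) (U₀ : GaugeField (i.1.1.P i.1.2.2) 0 (Matrix.specialUnitaryGroup (Fin 2) ℂ)), RegPr i.1.1 i.1.2.1 i.1.2.2 (α L) U₀ →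
      ∀ A : Space115 (i.1.1.L : ℝ) (((i.1.1.L : ℝ)⁻¹) ^ (i.1.2.2 - i.1.2.1)) (fun _ : Bond 3 (periodsT3 i.1.1 i.1.2.2) => i.1.2.2 - i.1.2.1)
          (fun _ : Bond 3 (periodsT3 i.1.1 i.1.2.2) × Fin 3 => i.1.2.2 - i.1.2.1) (nabla115 (((i.1.1.L : ℝ)⁻¹) ^ (i.1.2.2 - i.1.2.1)) (bgOfCfg i.1.1 i.1.2.2 U₀)),
        ‖A‖ < a₃ L → (∀ b, (JetSup.equiv _ _ _ A b).IsHermitian ∧ (JetSup.equiv _ _ _ A b).trace = 0) →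
        ∀ b, (NegSup.equiv _ _ (curV0full (rieszτ frobEquiv) (LinearMap.toContinuousLinearMap (Matrix.traceLinearMap (Fin 2) ℂ ℂ)) (bgOfCfg i.1.1 i.1.2.2 U₀)
              (H1f i.1.1 i.1.2.1 i.1.2.2 i.2.2.le (c₀ L) (cB L) (a L i) (DeltaPiSlotP i.1.1 i.1.2.1 i.1.2.2 i.2.2.le (c₀ L) (cB L) (a L i)) U₀)
              (fun A' => (-Complex.I) • CmapTwS i.1.1 i.1.2.1 i.1.2.2 i.2.2.le U₀ (((((eta i.1.1 i.1.2.1 i.1.2.2 : ℝ) : ℂ)) * Complex.I) • (fun b : PBond (i.1.1.P i.1.2.2) 0 => JetSup.equiv _ _ _ A' (bondEquiv i.1.1 i.1.2.2 b))))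
              (εC L) A) b).IsHermitian ∧
          (NegSup.equiv _ _ (curV0full (rieszτ frobEquiv) (LinearMap.toContinuousLinearMap (Matrix.traceLinearMap (Fin 2) ℂ ℂ)) (bgOfCfg i.1.1 i.1.2.2 U₀)
              (H1f i.1.1 i.1.2.1 i.1.2.2 i.2.2.le (c₀ L) (cB L) (a L i) (DeltaPiSlotP i.1.1 i.1.2.1 i.1.2.2 i.2.2.le (c₀ L) (cB L) (a L i)) U₀)
              (fun A' => (-Complex.I) • CmapTwS i.1.1 i.1.2.1 i.1.2.2 i.2.2.le U₀ (((((eta i.1.1 i.1.2.1 i.1.2.2 : ℝ) : ℂ)) * Complex.I) • (fun b : PBond (i.1.1.P i.1.2.2) 0 => JetSup.equiv _ _ _ A' (bondEquiv i.1.1 i.1.2.2 b))))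
              (εC L) A) b).trace = 0 :=
  hV0_of_RC_family α a₃ ef εC B₀ hα hef hWe hWε c₀ cB a ha
    (hRC_of_rows_family_B₀ B₀ α a₃ ef εC hB₀ hα hef hWe hWε c₀ cB a norm_Hπ hεC hdomC hselfC hcontrC)

end Summit.QuantumFields.YangMills.Theorems.Prop7V0CurrentRealityE2E

end
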